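import Literature.Computability.MetaComplexity.EFModAddAssoc
import HarnessLib

/-!
# Operation kits: the interface of a binary word operation inside extended Frege

Layer E/1 of the `EF`-proof construction kit. The chain constructions of the later layers
(multiplication as a chain of modular additions, exponentiation as a chain of multiplications)
are generic in the underlying operation. This file fixes the interface: an **operation kit**
`OpKit W` is a template with the input convention `x` (`W` bits), `y` (`W` bits), `n` (`W` bits),
designated result wires, an internal comparator of the result with `n` (the *domain* of a word
`x` being the certificate `x < n`, `ModAdd.LtN`), a unit bit pattern `e`, and three laws derived
inside Frege in polynomial size, each with its auxiliary template and wiring specification: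
domain closure, the left unit law `e ∘ y = y`, and the medial law
`(x ∘ y) ∘ (z ∘ w) = (x ∘ z) ∘ (y ∘ w)`.

Also: congruence of occurrences of a template (`Netlist.occLeib`), the wiring vocabulary of
auxiliary occurrences (`Src`, `AuxWired`), and the bundle of global facts (`GlobW`: the words
`0` and `1` in the domain).

## Sources

* S. A. Cook, R. A. Reckhow, *The relative efficiency of propositional proof systems*,
  J. Symbolic Logic 44 (1979), §2.
* J. Krajíček, *Bounded Arithmetic, Propositional Logic, and Complexity Theory* (CUP 1995), §9.2
  (polynomial-size `EF` derivations of algebraic identities of definable functions).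
* H. Vollmer, *Introduction to Circuit Complexity* (Springer 1999), §1.2.
-/

namespace Literature.Computability.MetaComplexity

open _root_.Computability Complexity Complexity.PropForm FregeSystem

namespace Netlist

variable {G : FregeSystem} {K : PropForm ℕ} {Γ : Set (PropForm ℕ)}

/-- **Congruence of occurrences**: two available occurrences of a well-formed template whose
inputs are provably equal have provably equal gates. [cite: CookReckhow1979, §2] -/
theorem occLeib (hG : ∀ r ∈ rules, r ∈ G.rules) {t : Template} {nIn : ℕ} (hwf : t.WF nIn) (o o' : Occ)
    (ho : o.Avail t nIn K Γ) (ho' : o'.Avail t nIn K Γ) (hin : ∀ i < nIn, ctx K (eqv (o.inp i) (o'.inp i)) ∈ Γ) :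
    G.Yields Γ {χ | χ ∈ leibLines (o.inst nIn) (o'.inst nIn) K t.length} (t.length * (K.size + 10)) := by
  refine Yields.of_isBlock (isBlock_leibLines hG hwf (o.inst nIn) (o'.inst nIn) K ho ho' (fun i hi => ?_) t.length le_rfl) subset_rfl
    (proofSize_map_range_le fun k _ => by simp [ctx, eqv, size, FregeSystem.size_biimp])
  rw [o.getD_inst hi, o'.getD_inst hi]; exact hin i hi

/-- The equality of gate `k` is in the congruence block. [folklore] -/
theorem wire_mem_occLeib {o o' : Occ} {nIn : ℕ} {K : PropForm ℕ} {L k : ℕ} (hk : k < L) :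
    ctx K (eqv (o.base + k) (o'.base + k)) ∈ leibLines (o.inst nIn) (o'.inst nIn) K L :=
  mem_leibLines hk

/-! ### Wiring of auxiliary occurrences -/

/-- A source of an auxiliary input: input `i` or gate `g` of the `j`-th occurrence of a law.
[folklore] -/
inductive Src where
  /-- input `i` of occurrence `j` -/
  | inp (j i : ℕ)
  /-- gate `g` of occurrence `j` -/
  | gate (j g : ℕ)

/-- The variable a source denotes, for a family of occurrences. [folklore] -/
def Src.val (os : ℕ → Occ) : Src → ℕ
  | .inp j i => (os j).inp i
  | .gate j g => (os j).base + g

/-- A source is in range for `N` occurrences of a template with `nIn` inputs and `L` gates.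
[folklore] -/
def Src.OK (N nIn L : ℕ) : Src → Prop
  | .inp j i => j < N ∧ i < nIn
  | .gate j g => j < N ∧ g < L

/-- `AuxWired m src os a`: the `m` inputs of the auxiliary occurrence `a` read the sources `src`
among the occurrences `os`. [folklore] -/
def AuxWired (m : ℕ) (src : ℕ → Src) (os : ℕ → Occ) (a : Occ) : Prop := ∀ k < m, a.inp k = (src k).val os

/-- An auxiliary template with its input count and source specification. [folklore] -/
structure LawAux where
  /-- the template -/
  T : Template
  /-- its number of inputs -/
  nIn : ℕ
  /-- the sources of its inputs -/
  src : ℕ → Src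

end Netlist

open Netlist

namespace ModAdd

/-! ### Global facts -/

/-- `GlobW W m K Γ nv`: the words `0` and `1` are available as literals and certified `< n`, and
the bits of `n` from position `m` on are false (the convention of zero-extended `W`-bit words
carrying `m`-bit numbers). [folklore] -/
structure GlobW (W m : ℕ) (K : PropForm ℕ) (Γ : Set (PropForm ℕ)) (nv : ℕ → ℕ) : Prop where
  /-- a zero word below `n` (so `0 < n`) -/
  zero : ∃ zw : ℕ → ℕ, Holds K Γ (litW zw (fun _ => false) W) ∧ LtN W K Γ zw nv
  /-- a one word below `n` (so `1 < n`) -/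
  one : ∃ ow : ℕ → ℕ, Holds K Γ (litW ow (fun i => decide (i = 0)) W) ∧ LtN W K Γ ow nv
  /-- the high bits of `n` are false -/
  nhigh : ∀ i, m ≤ i → i < W → ctx K (neg (var (nv i))) ∈ Γ

/-- Global facts are monotone. [folklore] -/
theorem GlobW.mono {W m : ℕ} {K : PropForm ℕ} {Γ Γ' : Set (PropForm ℕ)} {nv : ℕ → ℕ} (h : GlobW W m K Γ nv) (hΓ : Γ ⊆ Γ') :
    GlobW W m K Γ' nv := by
  obtain ⟨⟨zw, hz, hzl⟩, ⟨ow, ho, hol⟩, hn⟩ := h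
  exact ⟨⟨zw, hz.mono hΓ, hzl.mono hΓ⟩, ⟨ow, ho.mono hΓ, hol.mono hΓ⟩, fun i hi hi' => hΓ (hn i hi hi')⟩

/-- Global facts only depend on `n` below `W`. [folklore] -/
theorem GlobW.congr {W m : ℕ} {K : PropForm ℕ} {Γ : Set (PropForm ℕ)} {nv nv' : ℕ → ℕ} (h : GlobW W m K Γ nv) (hn : ∀ i < W, nv' i = nv i) :
    GlobW W m K Γ nv' := by
  obtain ⟨⟨zw, hz, hzl⟩, ⟨ow, ho, hol⟩, hnh⟩ := h
  exact ⟨⟨zw, hz, hzl.congr (fun _ _ => rfl) hn⟩, ⟨ow, ho, hol.congr (fun _ _ => rfl) hn⟩, fun i hi hi' => by rw [hn i hi']; exact hnh i hi hi'⟩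

/-! ### Operation kits -/

/-- The first operand of an occurrence under the convention `x, y, n`. [folklore] -/
def ox (o : Occ) : ℕ → ℕ := o.inp
/-- The second operand. [folklore] -/
def oy (W : ℕ) (o : Occ) : ℕ → ℕ := fun i => o.inp (W + i)
/-- The modulus. [folklore] -/
def on (W : ℕ) (o : Occ) : ℕ → ℕ := fun i => o.inp (2 * W + i)

/-- `MShape W res os`: six occurrences in the shape of the medial law — `os 0 = x ∘ y`,
`os 1 = z ∘ w`, `os 2 = (x ∘ y) ∘ (z ∘ w)`, `os 3 = x ∘ z`, `os 4 = y ∘ w`, `os 5 = (x ∘ z) ∘ (y ∘ w)`,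
all with the same `n`. [folklore] -/
structure MShape (W : ℕ) (res : Occ → ℕ → ℕ) (os : ℕ → Occ) : Prop where
  /-- `os 2` reads the results of `os 0`, `os 1` -/
  h2x : ∀ i < W, (os 2).inp i = res (os 0) i
  /-- second operand of `os 2` -/
  h2y : ∀ i < W, (os 2).inp (W + i) = res (os 1) i
  /-- `os 3 = x ∘ z` -/
  h3x : ∀ i < W, (os 3).inp i = (os 0).inp i
  /-- second operand of `os 3` -/
  h3y : ∀ i < W, (os 3).inp (W + i) = (os 1).inp i
  /-- `os 4 = y ∘ w` -/
  h4x : ∀ i < W, (os 4).inp i = (os 0).inp (W + i)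
  /-- second operand of `os 4` -/
  h4y : ∀ i < W, (os 4).inp (W + i) = (os 1).inp (W + i)
  /-- `os 5` reads the results of `os 3`, `os 4` -/
  h5x : ∀ i < W, (os 5).inp i = res (os 3) i
  /-- second operand of `os 5` -/
  h5y : ∀ i < W, (os 5).inp (W + i) = res (os 4) i
  /-- the same `n` everywhere -/
  hn : ∀ j, 0 < j → j < 6 → ∀ i < W, (os j).inp (2 * W + i) = (os 0).inp (2 * W + i)

/-- **An operation kit** on `W`-bit words: a template computing a binary operation `x ∘ y`
(inputs `x, y, n`), with result wires, an internal comparator of the result with `n`, a unit bit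
pattern, a class of Frege systems containing the needed rules, and three laws — domain closure,
left unit, medial — each derived inside Frege in size affine in `|K|`, from available occurrences,
an available auxiliary occurrence wired as specified, the domain certificates of the operands and
the global facts. [cite: Krajicek1995, §9.2] -/
structure OpKit (W : ℕ) where
  /-- the number of significant bits of the numbers carried by the `W`-bit words -/
  m : ℕ
  /-- the template of the operation -/
  T : Template
  /-- well-formedness, `3W` inputs -/
  wf : T.WF (3 * W)
  /-- offsets of the result wires -/
  resOff : ℕ → ℕ
  /-- the result wires are gates -/
  resOff_lt : ∀ i < W, resOff i < T.length
  /-- offset of the internal comparator of the result with `n` -/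
  cmpOff : ℕ
  /-- the comparator is available in an available occurrence -/
  cmp_avail : ∀ {K : PropForm ℕ} {Γ : Set (PropForm ℕ)} (o : Occ), o.Avail T (3 * W) K Γ →
    (⟨o.base + cmpOff, fun i => o.base + resOff i, on W o⟩ : Sub.View).Avail K Γ W
  /-- the unit bit pattern -/
  e : ℕ → Bool
  /-- the global facts provide a unit word in the domain -/
  e_glob : ∀ {K : PropForm ℕ} {Γ : Set (PropForm ℕ)} {nv : ℕ → ℕ}, GlobW W m K Γ nv → ∃ ew : ℕ → ℕ, Holds K Γ (litW ew e W) ∧ LtN W K Γ ew nv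
  /-- the Frege systems with enough rules -/
  Rules : FregeSystem → Prop
  /-- they contain the rules of the arithmetic kit -/
  rules_ok : ∀ {G : FregeSystem}, Rules G → ARulesOK G
  /-- a finite list of rules sufficient for the laws -/
  ruleList : List FregeRule
  /-- every rule of the list is sound -/
  rules_sound : ∀ r ∈ ruleList, r.IsSound
  /-- a Frege system containing the list has enough rules -/
  rules_of : ∀ {G : FregeSystem}, (∀ r ∈ ruleList, r ∈ G.rules) → Rules G
  /-- auxiliary template of domain closure -/
  domA : LawAux
  /-- its well-formedness -/
  domA_wf : domA.T.WF domA.nIn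
  /-- its sources are inputs and gates of the occurrence -/
  domA_ok : ∀ q < domA.nIn, (domA.src q).OK 1 (3 * W) T.length
  /-- size coefficients of domain closure -/
  domC : ℕ × ℕ
  /-- **domain closure**: `x, y < n` give `x ∘ y < n` -/
  dom : ∀ {G : FregeSystem}, Rules G → ∀ {K : PropForm ℕ} {Γ : Set (PropForm ℕ)} {o a : Occ}, o.Avail T (3 * W) K Γ →
    a.Avail domA.T domA.nIn K Γ → AuxWired domA.nIn domA.src (fun _ => o) a → LtN W K Γ (ox o) (on W o) → LtN W K Γ (oy W o) (on W o) →
    GlobW W m K Γ (on W o) →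
    G.Yields Γ {ctx K (neg (var ((⟨o.base + cmpOff, fun i => o.base + resOff i, on W o⟩ : Sub.View).ge W W)))} (domC.1 * (K.size + domC.2))
  /-- auxiliary template of the left unit law -/
  unitA : LawAux
  /-- its well-formedness -/
  unitA_wf : unitA.T.WF unitA.nIn
  /-- its sources are inputs and gates of the occurrence -/
  unitA_ok : ∀ q < unitA.nIn, (unitA.src q).OK 1 (3 * W) T.length
  /-- size coefficients of the left unit law -/
  unitC : ℕ × ℕ
  /-- **left unit**: `e ∘ y = y` for `y < n` -/
  unitL : ∀ {G : FregeSystem}, Rules G → ∀ {K : PropForm ℕ} {Γ : Set (PropForm ℕ)} {o a : Occ}, o.Avail T (3 * W) K Γ →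
    a.Avail unitA.T unitA.nIn K Γ → AuxWired unitA.nIn unitA.src (fun _ => o) a → Holds K Γ (litW (ox o) e W) → LtN W K Γ (oy W o) (on W o) →
    GlobW W m K Γ (on W o) → G.Yields Γ (ctxSet K (eqW (fun i => o.base + resOff i) (oy W o) W)) (unitC.1 * (K.size + unitC.2))
  /-- auxiliary template of the medial law -/
  medA : LawAux
  /-- its well-formedness -/
  medA_wf : medA.T.WF medA.nIn
  /-- its sources are inputs and gates of the six occurrences -/
  medA_ok : ∀ q < medA.nIn, (medA.src q).OK 6 (3 * W) T.length
  /-- size coefficients of the medial law -/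
  medC : ℕ × ℕ
  /-- **medial law**: `(x ∘ y) ∘ (z ∘ w) = (x ∘ z) ∘ (y ∘ w)` for `x, y, z, w < n` -/
  medial : ∀ {G : FregeSystem}, Rules G → ∀ {K : PropForm ℕ} {Γ : Set (PropForm ℕ)} {os : ℕ → Occ} {a : Occ},
    (∀ j < 6, (os j).Avail T (3 * W) K Γ) → MShape W (fun o i => o.base + resOff i) os → a.Avail medA.T medA.nIn K Γ →
    AuxWired medA.nIn medA.src os a → LtN W K Γ (ox (os 0)) (on W (os 0)) → LtN W K Γ (oy W (os 0)) (on W (os 0)) →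
    LtN W K Γ (ox (os 1)) (on W (os 0)) → LtN W K Γ (oy W (os 1)) (on W (os 0)) → GlobW W m K Γ (on W (os 0)) →
    G.Yields Γ (ctxSet K (eqW (fun i => (os 2).base + resOff i) (fun i => (os 5).base + resOff i) W)) (medC.1 * (K.size + medC.2))

namespace OpKit

variable {W : ℕ} (k : OpKit W)

/-- The result word of an occurrence. [folklore] -/
def res (o : Occ) : ℕ → ℕ := fun i => o.base + k.resOff i

/-- The internal comparator view of an occurrence. [folklore] -/
def cmpV (o : Occ) : Sub.View := ⟨o.base + k.cmpOff, k.res o, on W o⟩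

/-- **The domain certificate of a result** from the domain law. [cite: CookReckhow1979, §2] -/
theorem ltN_res {G : FregeSystem} (hG : k.Rules G) {K : PropForm ℕ} {Γ : Set (PropForm ℕ)} {o a : Occ} (ho : o.Avail k.T (3 * W) K Γ)
    (ha : a.Avail k.domA.T k.domA.nIn K Γ) (hw : AuxWired k.domA.nIn k.domA.src (fun _ => o) a) (hx : LtN W K Γ (ox o) (on W o))
    (hy : LtN W K Γ (oy W o) (on W o)) (hg : GlobW W k.m K Γ (on W o)) :
    ∃ Δ : Set (PropForm ℕ), G.Yields Γ Δ (k.domC.1 * (K.size + k.domC.2)) ∧ LtN W K (Γ ∪ Δ) (k.res o) (on W o) :=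
  ⟨_, k.dom hG ho ha hw hx hy hg, ⟨o.base + k.cmpOff, (k.cmp_avail o ho).mono Set.subset_union_left, Or.inr rfl⟩⟩

end OpKit

end ModAdd

end Literature.Computability.MetaComplexity
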